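import Literature.Barriers.ValiantsHypothesis.PlethysmCodeMachine
import Literature.RepresentationTheory.GeneralLinear.PlethysmTomographyBounds
import Literature.Computability.Complexity.DiscreteTomographySymmetrizationFP
import Literature.Computability.Complexity.TwoDXRayCircuitBoard
import Literature.NumberTheory.DiophantineGeometry.SchurWeylPlethysmHwMultiplicityProofs
import HarnessLib

/-!
# PLETHYSM hardness for inner parameter `3`: (SKEW-)SYMMETRIC-2D-X-RAY Karp-reduce to the
# word-model plethysm languages (Fischer–Ikenmeyer 2020, Lemmas 4–5 and Thm. 4 assembled)

N. Fischer, C. Ikenmeyer, *The computational complexity of plethysm coefficients*, Comput.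
Complexity 29 (2020) 8, §6, Fig. 2: `2D-X-RAY → (SKEW-)SYMMETRIC-2D-X-RAY → PROMISE-(SKEW-)SYMMETRIC-
3D-X-RAY → (DUAL)PLETHYSM(3)`, the last arrow being Lemma 4 ("if `λ` is a partition, then the
reduction outputs its input `(λ, n)`. Since `B(λ) = β̄(|λ|/3)`, Prop. 2 ensures that
`b⁺_λ(n,3) = b_λ(n,3)`") on top of Thm. 4 (pyramids / point sets in the cones bound the
multiplicities).

**The languages.** For a family of `±1`-characters `χ n` of the wreath products `S_n ≀ S_m` the
language `wreathLang m χ` consists of the codes `encodePartition μ ++ unaryNat n` (the coding of the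
barrier file `KroneckerPositivityHardness.lean`) of the pairs `(μ ⊢ n·m, n)` whose space
`wreathHW ℂ (n·m) (χ n) μ` of `χ n`-isotypic highest-weight vectors of weight `μ` in `(ℂ^{nm})^{⊗nm}`
is nonzero (`WreathHighestWeight.lean`). By `PlethysmWordModel.lean` (FI Fact 1),
`(λ, n) ∈ PLETHYSMPOSITIVITY(m)` iff `(λᵀ, n) ∈ wreathLang m s` (`s` = restricted sign); for `m = 3`
the characters `s` and `σₒ` cut out `Λⁿ Λ³` and `Λⁿ Sym³`, whose highest-weight vectors are governed by
the open / closed cone (Thm. 4, `PlethysmTomographyBounds.lean`).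

**What is proved.**
* `Tomography.exists_isPyramid_of_mem_symSetK`: a solution `P̂ ⊆ G_r ∩ K` of a (SKEW-)SYMMETRIC
  instance `λ̂` gives the PYRAMID `P = pyrBelow K r ∪ P̂` with `S(P) = addPyr K λ̂` (Lemma 7; the point
  of the promise `B(λ) = β(|λ|/3)` in Lemma 4 — every solution is a pyramid, Prop. 2 — is thus built in,
  and no `β` needs to be computed).
* `mem_symSetK_iff_convF_mem` (Lemma 4 ∘ Lemma 7 on lists): `λ̂ ∈ (SKEW-)SYM-2D-X-RAY` iff the
  partition code of `(addPyr K λ̂, n)` lies in `wreathLang 3 χ` (`χ = s` for the open cone, `σₒ` for the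
  closed cone): `⇒` by the lower bound of Thm. 4 (the pyramid gives a nonzero highest-weight vector;
  its weight is dominant, so `addPyr K λ̂` IS a partition — replacing FI's Lemma 3), `⇐` by the upper
  bound (a nonzero vector gives a point set with sum-marginal `addPyr K λ̂`, and the tree's
  `mem_of_addPyr_mem`, Lemmas 6–7).
* `SKEWSYMTWODXRAY_karpReducible_wreathLang`, `SYMTWODXRAY_karpReducible_wreathLang`: the string maps
  `PlethCode.convF ∘ Tomography.redFn s` are Karp reductions; with the tree's discharged leaves
  (`GardnerGritzmannPrangenberg1999_twoDXRay_NPHard_holds`, `FischerIkenmeyer2020_lemma8_holds`):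
  **`isNPHard_wreathLang_three_restrSign`** and **`isNPHard_wreathLang_three_outerSign`** — the word-model
  forms of "PLETHYSMPOSITIVITY(3) and DUALPLETHYSMPOSITIVITY(3) are NP-hard".

## References

* [FischerIkenmeyer2020] §5 (Thm. 4, Prop. 2), §6 (Problems 7, 10; Lemmas 3–8; Fig. 2), Thm. 1.
* [GardnerGritzmannPrangenberg1999] Thm. 3.7 (2D-X-RAY).
-/

noncomputable section

open scoped BigOperators

namespace Literature.Computability.Complexity.Tomography

variable (K : Point → Prop) [DecidablePred K]

/-- **The pyramid of Lemma 7.** A solution `P̂ ⊆ G_r ∩ K` of the (SKEW-)SYMMETRIC-2D-X-RAY instance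
`λ̂` yields the pyramid `P = pyrBelow K r ∪ P̂` in `K` (every point of `K` below a point of `P` has
smaller coordinate sum, or is that point) with sum-marginal `addPyr K λ̂`, `|addPyr K λ̂| = 3|P|`, and
coordinates `≤ r`. [cite: FischerIkenmeyer2020, Lemma 7 (and Lemma 6)] -/
theorem exists_isPyramid_of_mem_symSetK {l : List ℕ} (h : l ∈ symSetK K) :
    ∃ P : Finset Point, IsPyramid K P ∧ sumMarginal P = listFn (addPyr K l) ∧
      (addPyr K l).sum = 3 * P.card ∧ ∀ p ∈ P, p.1 < (addPyr K l).length := by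
  obtain ⟨r, hl, P, hP, hS⟩ := h
  have hr : l.length - 1 = r := by omega
  have hlayer : P ⊆ layer K r := fun p hp => mem_layer.2 (hP p hp)
  have hdisj : Disjoint (pyrBelow K r) P :=
    Finset.disjoint_of_subset_right hlayer (disjoint_pyrBelow_layer K r)
  have hboxQ : pyrBelow K r ⊆ box (r + 1) := (pyrBelow_subset_box r).trans (box_mono (Nat.le_succ r))
  have hboxP : P ⊆ box (r + 1) := hl ▸ subset_box_of_sumMarginal_eq hS
  have hbox : pyrBelow K r ∪ P ⊆ box (r + 1) := Finset.union_subset hboxQ hboxP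
  have hfn : listFn (addPyr K l) = sumMarginal (pyrBelow K r ∪ P) := by
    rw [listFn_addPyr_eq, hr, sumMarginal_union hdisj, hS]
  refine ⟨pyrBelow K r ∪ P, ⟨fun p hp => ?_, fun p hp q hq hb => ?_⟩, hfn.symm, ?_, fun p hp => ?_⟩
  · rcases Finset.mem_union.1 hp with hp | hp
    · exact (mem_pyrBelow.1 hp).1
    · exact (hP p hp).1
  · -- downward closure in `K`
    obtain ⟨h1, h2, h3⟩ := hb
    have hsum : coordSum q ≤ coordSum p := by simp only [coordSum]; omega
    rcases Finset.mem_union.1 hp with hp | hp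
    · exact Finset.mem_union.2 (Or.inl (mem_pyrBelow.2 ⟨hq, hsum.trans_lt (mem_pyrBelow.1 hp).2⟩))
    · rcases (hsum.trans_eq (hP p hp).2).lt_or_eq with hlt | heq
      · exact Finset.mem_union.2 (Or.inl (mem_pyrBelow.2 ⟨hq, hlt⟩))
      · have hpr := (hP p hp).2
        have : q = p := by
          simp only [coordSum] at heq hpr
          ext <;> omega
        rw [this]
        exact Finset.mem_union.2 (Or.inr hp)
  · rw [sum_eq_sum_range_listFn, length_addPyr, hl, hfn, sum_sumMarginal hbox]
  · rw [length_addPyr, hl]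
    exact (mem_box.1 (hbox hp)).1

end Literature.Computability.Complexity.Tomography

namespace Literature.Barriers.ValiantsHypothesis

open Literature.Computability.Complexity Literature.Computability.Complexity.Tomography
open Literature.NumberTheory.DiophantineGeometry Literature.RepresentationTheory.GeneralLinear
open Literature.Computability.AlgebraicComplexity
open scoped Literature.Computability.Complexity.Notation

/-! ### Compositions that are partitions -/

namespace PlethCode

/-- A weakly decreasing composition is an antitone sequence. [folklore] -/
theorem antitone_listFn {l : List ℕ} (h : AntiL l) : Antitone (listFn l) := by
  refine antitone_nat_of_succ_le fun j => ?_
  by_cases hj : j < l.length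
  · exact h j hj
  · rw [listFn_of_le (by omega)]
    exact Nat.zero_le _

/-- Conversely, an antitone sequence is a weakly decreasing composition. [folklore] -/
theorem antiL_of_antitone {l : List ℕ} (h : Antitone (listFn l)) : AntiL l :=
  fun j _ => h (Nat.le_succ j)

/-- A weakly decreasing composition is a `≥`-sorted list. [folklore] -/
theorem pairwise_ge {l : List ℕ} (h : Antitone (listFn l)) : l.Pairwise (· ≥ ·) := by
  rw [List.pairwise_iff_getElem]
  intro i j hi hj hij
  have := h hij.le
  rwa [listFn_of_lt hi, listFn_of_lt hj] at this

/-- Dropping the zero entries of a weakly decreasing composition does not change its entries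
(the zeros form a suffix). [folklore] -/
theorem getD_filter_ne_zero : ∀ {l : List ℕ}, Antitone (listFn l) → ∀ i, (l.filter (· ≠ 0)).getD i 0 = listFn l i
  | [], _, i => by simp [listFn]
  | a :: t, h, i => by
    have ht : Antitone (listFn t) := by
      intro x y hxy
      have := h (Nat.succ_le_succ hxy)
      simpa [listFn] using this
    by_cases ha : a = 0
    · subst ha
      have h0 : ∀ j, listFn (0 :: t) j = 0 := fun j => by
        have := h (Nat.zero_le j)
        simpa [listFn] using this
      have ht0 : ∀ j, listFn t j = 0 := fun j => by have := h0 (j + 1); simpa [listFn] using this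
      rw [List.filter_cons_of_neg (by simp), getD_filter_ne_zero ht i, ht0 i, h0 i]
    · rw [List.filter_cons_of_pos (by simpa using ha)]
      cases i with
      | zero => simp [listFn]
      | succ i => simpa [listFn] using getD_filter_ne_zero ht i

/-- The sum of the nonzero entries is the sum. [folklore] -/
theorem sum_filter_ne_zero : ∀ l : List ℕ, (l.filter (· ≠ 0)).sum = l.sum
  | [] => rfl
  | a :: t => by
    by_cases ha : a = 0
    · subst ha; rw [List.filter_cons_of_neg (by simp), List.sum_cons, zero_add, sum_filter_ne_zero t]
    · rw [List.filter_cons_of_pos (by simpa using ha), List.sum_cons, List.sum_cons, sum_filter_ne_zero t]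

/-- Beyond its sum, a weakly decreasing composition vanishes. [folklore] -/
theorem listFn_eq_zero_of_sum_le {l : List ℕ} (h : Antitone (listFn l)) {i : ℕ} (hi : l.sum ≤ i) :
    listFn l i = 0 := by
  by_contra hne
  have hpos : ∀ j ≤ i, 1 ≤ listFn l j := fun j hj => by
    have := h hj; omega
  have hil : i < l.length := by
    by_contra hge
    exact hne (listFn_of_le (not_lt.1 hge))
  have h1 : i + 1 ≤ ∑ j ∈ Finset.range (i + 1), listFn l j := by
    calc i + 1 = ∑ _j ∈ Finset.range (i + 1), 1 := by simp
      _ ≤ ∑ j ∈ Finset.range (i + 1), listFn l j :=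
        Finset.sum_le_sum fun j hj => hpos j (Nat.lt_succ_iff.mp (Finset.mem_range.mp hj))
  have h2 : ∑ j ∈ Finset.range (i + 1), listFn l j ≤ l.sum := by
    rw [sum_eq_sum_range_listFn]
    exact Finset.sum_le_sum_of_subset (Finset.range_mono (by omega))
  omega

/-- **The partition of a weakly decreasing composition** with `|λ| = 3n`: parts = the nonzero entries.
[cite: FischerIkenmeyer2020, §2 ("we always treat [compositions] as finite by omitting trailing zeros. If the entries are nonincreasing, then we call λ a partition")] -/
def partOfComp (l : List ℕ) (n : ℕ) (h : l.sum = n * 3) : Nat.Partition (n * 3) where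
  parts := (l.filter (· ≠ 0) : List ℕ)
  parts_pos ha := Nat.pos_of_ne_zero (by
    have := List.of_mem_filter (Multiset.mem_coe.1 ha)
    simpa using this)
  parts_sum := by rw [Multiset.sum_coe, sum_filter_ne_zero, h]

/-- Its sorted parts are the nonzero entries in their order. [folklore] -/
theorem sortedParts_partOfComp {l : List ℕ} (ha : Antitone (listFn l)) (n : ℕ) (h : l.sum = n * 3) :
    (partOfComp l n h).sortedParts = l.filter (· ≠ 0) := by
  have hp : (partOfComp l n h).sortedParts.Perm (l.filter (· ≠ 0)) :=
    Quotient.exact (Multiset.sort_eq _ _)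
  exact hp.eq_of_sortedGE (Nat.Partition.sortedGE_sortedParts _)
    (List.sortedGE_iff_pairwise.mpr ((pairwise_ge ha).filter _))

/-- Its code is `unaryList` of the nonzero entries. [folklore] -/
theorem encodePartition_partOfComp {l : List ℕ} (ha : Antitone (listFn l)) (n : ℕ) (h : l.sum = n * 3) :
    encodePartition (partOfComp l n h) = unaryList (l.filter (· ≠ 0)) := by
  rw [encodePartition, sortedParts_partOfComp ha]

/-- Its weight for `GL_N` is the composition itself (restricted to `[0, N)`). [folklore] -/
theorem ofPartition_partOfComp {l : List ℕ} (ha : Antitone (listFn l)) (n : ℕ) (h : l.sum = n * 3) (N : ℕ) :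
    Weight.ofPartition N (partOfComp l n h) = fun i : Fin N => (listFn l (i : ℕ) : ℤ) := by
  funext i
  rw [Weight.ofPartition, sortedParts_partOfComp ha, getD_filter_ne_zero ha]

/-- It has at most `|l|` parts. [folklore] -/
theorem card_parts_partOfComp_le (l : List ℕ) (n : ℕ) (h : l.sum = n * 3) :
    (partOfComp l n h).parts.card ≤ l.length := by
  change ((l.filter (· ≠ 0) : List ℕ) : Multiset ℕ).card ≤ l.length
  rw [Multiset.coe_card]
  exact List.length_filter_le _ _

end PlethCode

/-! ### The word-model plethysm languages -/

/-- **The word-model plethysm language** for inner parameter `m` and a family of `±1`-characters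
`χ n` of `S_n ≀ S_m`: codes `encodePartition μ ++ unaryNat n` with a nonzero space of
`χ n`-isotypic highest-weight vectors of weight `μ` in `(ℂ^{nm})^{⊗nm}`. For `χ n = s` (the
restricted sign) membership of `(λᵀ, n)` is `a_λ(n,m) > 0` (`PlethysmWordModel.lean`); for `m = 3`,
`χ = σₒ` it is the nonvanishing of the `Λⁿ Sym³` highest-weight space (`b_μ(n,3) > 0`, FI §5).
[cite: FischerIkenmeyer2020, §2 (eq. (2), Fact 1) and §3 (Problems 2, 4)] -/
def wreathLang (m : ℕ) (χ : (n : ℕ) → (↥(blockPerms n m) →* ℤˣ)) : Language Bool :=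
  {w | ∃ (n : ℕ) (μ : Nat.Partition (n * m)), w = encodePartition μ ++ unaryNat n ∧
    wreathHW ℂ (n * m) (χ n) (Weight.ofPartition (n * m) μ) ≠ ⊥}

/-- **Unique decoding**: the code of `(μ, n)` lies in `wreathLang m χ` iff its own highest-weight
space is nonzero. [folklore] -/
theorem mem_wreathLang_iff {m : ℕ} (χ : (n : ℕ) → (↥(blockPerms n m) →* ℤˣ)) (n : ℕ)
    (μ : Nat.Partition (n * m)) :
    encodePartition μ ++ unaryNat n ∈ wreathLang m χ ↔
      wreathHW ℂ (n * m) (χ n) (Weight.ofPartition (n * m) μ) ≠ ⊥ := by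
  constructor
  · rintro ⟨n', μ', he, h⟩
    obtain ⟨hs, hu⟩ := encodePartition_append_inj he
    have hn : n = n' := unaryNat_injective hu
    subst hn
    have hμ : μ = μ' := eq_of_sortedParts_eq hs
    subst hμ
    exact h
  · intro h
    exact ⟨n, μ, rfl, h⟩

/-- The empty word is in no `wreathLang` (every member ends with the nonempty block `1ⁿ 0`). [folklore] -/
theorem nil_not_mem_wreathLang {m : ℕ} (χ : (n : ℕ) → (↥(blockPerms n m) →* ℤˣ)) :
    ([] : List Bool) ∉ wreathLang m χ := by
  rintro ⟨n, μ, he, -⟩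
  have := congrArg List.length he
  simp [unaryNat] at this

/-! ### Weights of nonzero highest-weight spaces are partitions (replacing FI Lemma 3) -/

/-- If the composition `l` (length `≤ N`) is the weight of a nonzero `wreathHW`, then `l` is weakly
decreasing: highest weights of `(k^N)^{⊗D}` are dominant (the tree's `𝔰𝔩₂`-ladder
`highestWeightSpace_wordRep_eq_bot_of_lt`). This replaces FI's combinatorial Lemma 3 ("any promise
instance `λ` which is not a partition is trivially rejected"). [cite: FischerIkenmeyer2020, Lemma 3] -/
theorem antitone_of_wreathHW_ne_bot {N n m : ℕ} {χ : ↥(blockPerms n m) →* ℤˣ} {l : List ℕ}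
    (hN : l.length ≤ N) (h : wreathHW ℂ N χ (fun i : Fin N => (listFn l (i : ℕ) : ℤ)) ≠ ⊥) :
    Antitone (listFn l) := by
  refine PlethCode.antitone_listFn fun j hj => ?_
  by_cases hj1 : j + 1 < N
  · by_contra hlt
    rw [not_le] at hlt
    apply h
    rw [eq_bot_iff]
    refine (wreathHW_le_highestWeightSpace χ _).trans ?_
    rw [highestWeightSpace_wordRep_eq_bot_of_lt (k := ℂ) (m := n * m) (r := ⟨j, by omega⟩)
      (s := ⟨j + 1, hj1⟩) (Fin.mk_lt_mk.mpr (Nat.lt_succ_self j)) (by exact_mod_cast hlt)]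
  · rw [listFn_of_le (l := l) (i := j + 1) (by omega)]
    exact Nat.zero_le _

/-! ### Lemma 4 ∘ Lemma 7 on lists -/

section Lists

variable (K : Point → Prop) [DecidablePred K] (χ : (n : ℕ) → (↥(blockPerms n 3) →* ℤˣ))

/-- **FI Lemma 4 composed with Lemma 7, on compositions.** Let `K` be a cone, `χ` a family of
characters, and assume Thm. 4 for `(K, χ)` in positivity form: pyramids in `K` give nonzero vectors
of `wreathHW _ (χ n) (S(P))` (`hlower`) and nonzero vectors give point sets in `K` (`hupper`). Then for
a (SKEW-)SYMMETRIC-2D-X-RAY instance `λ̂` passing the arithmetic test `Good`, `λ̂` is a yes-instance iff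
the partition code of `(addPyr K λ̂, |addPyr K λ̂|/3)` — the output of the reduction — lies in
`wreathLang 3 χ`. [cite: FischerIkenmeyer2020, Lemma 4 and Lemma 7 (with Thm. 4, Prop. 2)] -/
theorem mem_symSetK_iff_convF_mem
    (hlower : ∀ (P : Finset Point) (n N : ℕ), IsPyramid K P → P.card = n → (∀ p ∈ P, p.1 < N) →
      ∃ x ∈ wreathHW ℂ N (χ n) (fun i => (sumMarginal P i : ℤ)), x ≠ 0)
    (hupper : ∀ (n N : ℕ) (μ : Weight (Fin N)), wreathHW ℂ N (χ n) μ ≠ ⊥ →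
      ∃ Q : Finset Point, (∀ q ∈ Q, K q) ∧ Q.card = n ∧ (∀ i : Fin N, (sumMarginal Q i : ℤ) = μ i) ∧
        ∀ i, N ≤ i → sumMarginal Q i = 0)
    {l : List ℕ} (hg : Good l) :
    l ∈ symSetK K ↔ PlethCode.convF (encodingComposition.encode (addPyr K l)) ∈ wreathLang 3 χ := by
  set l' := addPyr K l with hl'
  rw [PlethCode.convF_encode]
  constructor
  · intro h
    obtain ⟨P, hP, hS, hsum, hlt⟩ := exists_isPyramid_of_mem_symSetK K h
    obtain ⟨x, hx, hx0⟩ := hlower P P.card l'.length hP rfl hlt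
    have hw : (fun i : Fin l'.length => (sumMarginal P (i : ℕ) : ℤ)) =
        fun i : Fin l'.length => (listFn l' (i : ℕ) : ℤ) := by
      funext i; rw [hS]
    rw [hw] at hx
    have hne : wreathHW ℂ l'.length (χ P.card) (fun i : Fin l'.length => (listFn l' (i : ℕ) : ℤ)) ≠ ⊥ :=
      (Submodule.ne_bot_iff _).2 ⟨x, hx, hx0⟩
    have hanti : Antitone (listFn l') := antitone_of_wreathHW_ne_bot le_rfl hne
    have h3 : 3 ∣ l'.sum := ⟨P.card, hsum⟩
    have hdiv : l'.sum / 3 = P.card := by rw [hsum, Nat.mul_div_cancel_left _ (by norm_num)]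
    have hsum' : l'.sum = P.card * 3 := by rw [hsum, Nat.mul_comm]
    rw [if_pos ⟨h3, PlethCode.antiL_of_antitone hanti⟩, hdiv,
      ← PlethCode.encodePartition_partOfComp hanti P.card hsum', mem_wreathLang_iff]
    rw [← PlethCode.ofPartition_partOfComp hanti P.card hsum'] at hne
    exact (wreathHW_ne_bot_iff_of_card_le ℂ (χ P.card) _ (PlethCode.card_parts_partOfComp_le l' P.card hsum')
      (Nat.Partition.card_parts_le_size _)).mp hne
  · intro h
    by_cases hc : 3 ∣ l'.sum ∧ PlethCode.AntiL l'
    · rw [if_pos hc] at h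
      obtain ⟨h3, ha⟩ := hc
      have hanti : Antitone (listFn l') := PlethCode.antitone_listFn ha
      set n := l'.sum / 3 with hn
      have hsum' : l'.sum = n * 3 := by rw [hn, Nat.div_mul_cancel h3]
      rw [← PlethCode.encodePartition_partOfComp hanti n hsum', mem_wreathLang_iff,
        PlethCode.ofPartition_partOfComp hanti n hsum'] at h
      obtain ⟨Q, hQK, hcard, hSQ, hS0⟩ := hupper n (n * 3) _ h
      refine mem_of_addPyr_mem K hg ⟨Q, hQK, funext fun i => ?_⟩
      by_cases hi : i < n * 3
      · have := hSQ ⟨i, hi⟩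
        exact_mod_cast this
      · rw [not_lt] at hi
        rw [hS0 i hi, PlethCode.listFn_eq_zero_of_sum_le hanti (hsum' ▸ hi)]
    · rw [if_neg hc] at h
      exact (nil_not_mem_wreathLang χ h).elim

end Lists

/-! ### The string-level reductions -/

section Strings

variable (s : Bool) (K : Point → Prop) [DecidablePred K] (χ : (n : ℕ) → (↥(blockPerms n 3) →* ℤˣ))

/-- **The Karp reduction (SKEW-)SYMMETRIC-2D-X-RAY `≤ₚ wreathLang 3 χ`** under the hypotheses of
`mem_symSetK_iff_convF_mem`: the map `convF ∘ redFn s` (Lemma 5's machine followed by the code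
conversion of Lemma 4). [cite: FischerIkenmeyer2020, Lemmas 4–5] -/
theorem karpReducible_wreathLang_of_cone
    (hK : ∀ a b c : ℕ, K (a, b, c) ↔ (cmp s b a = true ∧ cmp s c b = true))
    (hlower : ∀ (P : Finset Point) (n N : ℕ), IsPyramid K P → P.card = n → (∀ p ∈ P, p.1 < N) →
      ∃ x ∈ wreathHW ℂ N (χ n) (fun i => (sumMarginal P i : ℤ)), x ≠ 0)
    (hupper : ∀ (n N : ℕ) (μ : Weight (Fin N)), wreathHW ℂ N (χ n) μ ≠ ⊥ →
      ∃ Q : Finset Point, (∀ q ∈ Q, K q) ∧ Q.card = n ∧ (∀ i : Fin N, (sumMarginal Q i : ℤ) = μ i) ∧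
        ∀ i, N ≤ i → sumMarginal Q i = 0) :
    encodingComposition.toLanguage (symSetK K) ≤ₚ wreathLang 3 χ := by
  refine ⟨PlethCode.convF ∘ redFn s, comp_mem_FP PlethCode.convF_mem_FP (redFn_mem_FP s), fun x => ?_⟩
  show x ∈ encodingComposition.toLanguage (symSetK K) ↔ PlethCode.convF (redFn s x) ∈ wreathLang 3 χ
  have hbad : PlethCode.convF badCode ∉ wreathLang 3 χ := by
    rw [badCode, badList, PlethCode.convF_encode, if_neg (by decide)]
    exact nil_not_mem_wreathLang χ
  by_cases hx : encodingComposition.encode (decComp x) = x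
  · rw [← hx, redFn_encode, encodingComposition.mem_toLanguage_iff]
    by_cases hg : Good (decComp x)
    · rw [if_pos hg, coreF_encode s _ hK]
      exact mem_symSetK_iff_convF_mem K χ hlower hupper hg
    · rw [if_neg hg]
      exact ⟨fun h => (hg (good_of_mem_symSetK h)).elim, fun h => (hbad h).elim⟩
  · rw [redFn_of_not_canon s hx]
    exact ⟨fun h => (hx (encode_decComp_of_mem h)).elim, fun h => (hbad h).elim⟩

end Strings

/-- **SKEW-SYMMETRIC-2D-X-RAY `≤ₚ wreathLang 3 s`** (open cone; `s` = restricted sign, the `Λⁿ Λ³`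
character): FI Lemma 5 + Lemma 4 + Thm. 4 for `a_λ(n,3)`. [cite: FischerIkenmeyer2020, Lemmas 4–5 and Thm. 4] -/
theorem SKEWSYMTWODXRAY_karpReducible_wreathLang :
    SKEWSYMTWODXRAY ≤ₚ wreathLang 3 (fun n => restrSign n 3) := by
  rw [SKEWSYMTWODXRAY, skewSymTwoDXRaySet_eq]
  refine karpReducible_wreathLang_of_cone true IsInOpenCone (fun n => restrSign n 3)
    (fun a b c => by simp [IsInOpenCone, Tomography.cmp]) (fun P n N hP hcard hN => ?_) (fun n N μ h => ?_)
  · exact exists_mem_wreathHW_of_isPyramid_open ℂ P hP hcard hN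
  · obtain ⟨Q, hK, hcard, -, hS, hS0⟩ := exists_pointSet_of_wreathHW_ne_bot_open h
    exact ⟨Q, hK, hcard, hS, hS0⟩

/-- **SYMMETRIC-2D-X-RAY `≤ₚ wreathLang 3 σₒ`** (closed cone; `σₒ` = sign of the block permutation, the
`Λⁿ Sym³` character): FI Lemma 5 + Lemma 4 + Thm. 4 for `b_λ(n,3)`. [cite: FischerIkenmeyer2020, Lemmas 4–5 and Thm. 4] -/
theorem SYMTWODXRAY_karpReducible_wreathLang :
    SYMTWODXRAY ≤ₚ wreathLang 3 (fun n => (outerSign : ↥(blockPerms n 3) →* ℤˣ)) := by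
  rw [SYMTWODXRAY, symTwoDXRaySet_eq]
  refine karpReducible_wreathLang_of_cone false IsInClosedCone (fun n => (outerSign : ↥(blockPerms n 3) →* ℤˣ))
    (fun a b c => by simp [IsInClosedCone, Tomography.cmp]) (fun P n N hP hcard hN => ?_) (fun n N μ h => ?_)
  · exact exists_mem_wreathHW_of_isPyramid_closed ℂ P hP hcard hN
  · obtain ⟨Q, hK, hcard, -, hS, hS0⟩ := exists_pointSet_of_wreathHW_ne_bot_closed h
    exact ⟨Q, hK, hcard, hS, hS0⟩

/-- `SKEWSYMTWODXRAY` is NP-hard (2D-X-RAY is, by the tree's discharged GGP leaf, and FI Lemma 8).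
[cite: FischerIkenmeyer2020, §6 (Fig. 2)] -/
theorem isNPHard_SKEWSYMTWODXRAY : IsNPHard SKEWSYMTWODXRAY := fun L hL =>
  PolyTimeKarpReducible.trans_holds (GardnerGritzmannPrangenberg1999_twoDXRay_NPHard_holds L hL)
    FischerIkenmeyer2020_lemma8_holds.2

/-- `SYMTWODXRAY` is NP-hard. [cite: FischerIkenmeyer2020, §6 (Fig. 2)] -/
theorem isNPHard_SYMTWODXRAY : IsNPHard SYMTWODXRAY := fun L hL =>
  PolyTimeKarpReducible.trans_holds (GardnerGritzmannPrangenberg1999_twoDXRay_NPHard_holds L hL)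
    FischerIkenmeyer2020_lemma8_holds.1

/-- **`wreathLang 3 s` is NP-hard** — the word-model form of "PLETHYSMPOSITIVITY(3) is NP-hard"
(`Λⁿ Λ³`, open cone). [cite: FischerIkenmeyer2020, Thm. 1 (m = 3) with §6 (Fig. 2)] -/
theorem isNPHard_wreathLang_three_restrSign : IsNPHard (wreathLang 3 fun n => restrSign n 3) := fun L hL =>
  PolyTimeKarpReducible.trans_holds (isNPHard_SKEWSYMTWODXRAY L hL) SKEWSYMTWODXRAY_karpReducible_wreathLang

/-- **`wreathLang 3 σₒ` is NP-hard** — the word-model form of "DUALPLETHYSMPOSITIVITY(3) is NP-hard"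
(`Λⁿ Sym³`, closed cone). [cite: FischerIkenmeyer2020, Thm. 1 (m = 3) with §6 (Fig. 2)] -/
theorem isNPHard_wreathLang_three_outerSign :
    IsNPHard (wreathLang 3 fun n => (outerSign : ↥(blockPerms n 3) →* ℤˣ)) := fun L hL =>
  PolyTimeKarpReducible.trans_holds (isNPHard_SYMTWODXRAY L hL) SYMTWODXRAY_karpReducible_wreathLang

end Literature.Barriers.ValiantsHypothesis
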